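import Summits.QuantumFields.YangMills.Theorems.FluctuationComparisonRegPrIntLS2BetaSmallBondGaugeToronAbelianStratum
import HarnessLib

/-!
# S2β ∕ GAP♯∘ (D)-side — NEAR-FLAT TORI ON THE IRREDUCIBLE STRATUM DEFEAT THE SMALL-BOND SUPPLIER TOO: the direction field `(e^{a·e₀σ}, e^{ε·e₁σ}, 1)` (two non-commuting
# Polyakov holonomies, plaquettes `≤ 2·dist1(e^{ε·e₁σ}) ≤ 2ε`) is IRREDUCIBLE (the `hD₁`∕`hF₁` guard of ✓`…S2BetaStrataOfGaugedLetters` VERBATIM) for `sin(Na) ≠ 0 ≠ sin(Nε)`, is `PlaqSmall θ`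
# for `ε ≤ θ∕4`, and carries the Polyakov arc `N·a` in direction `0` — so ✓`…ToronObstruction.not_hsupp_of_unreachable` refutes `hsupp(G_irr, G_irr ∧ small-bond M)` for `M < a`

Cell `ym3-torus` (YM ladder rung R3 = continuum `SU(2)` Yang–Mills on the three-torus — a RUNG: NOT d = 4, NOT infinite volume, NOT a mass gap, NOT Clay).
Width seat «width 8» `ym3-torus-px8` (gen 24), FREE px helper on crux `stmt-QuantumFields-20520`, count-neutral, DEFINITION-FREE, default heartbeats.  Elementary `2×2` algebra on
the torus lattice over ✓`…ToronObstruction` ∕ ✓`…ToronAbelianStratum`; nothing of Bałaban's asserted.  Sorry-free, axioms standard.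
-/

set_option autoImplicit false

noncomputable section

namespace Summit.QuantumFields.YangMills.Theorems.FluctuationComparisonRegPrIntLS2BetaSmallBondGaugeToronIrreducibleStratum

open scoped Real
open Literature.MathematicalPhysics.QuantumLattice (su2Quat quatMatrix quatMatrix_su2Quat quatMatrix_apply_00 quatMatrix_apply_01 quatMatrix_apply_10 quatMatrix_apply_11)
open Literature.MathematicalPhysics.QuantumFieldTheory.Balaban1983to89
open T4CubeChartGnomonic (SU2)
open T4HaarSU2ExpChart (imQuat expPoint su2Quat_expPoint exp_imQuat_smul)
open T4ExpWindowSmallField (logVec)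
open T3ContinuumYM3Torus (T3Family)
open T3UnitScaleTilt (θBal)
open B10Eq27TorusAxialLog (unitsField toUField)
open Summit.QuantumFields.YangMills.Theorems.CovariantDischargeUniformFluxLetters (dist1_expPoint_smul)
open Summit.QuantumFields.YangMills.Theorems.FluctuationComparisonRegPrIntLS2BetaGeodesicJensenLift (norm_logVec_su2Quat_expPoint)
open Summit.QuantumFields.YangMills.Theorems.FluctuationComparisonRegPrIntLS2BetaSmallBondGaugeToronObstruction
  (expPoint_smul_pow sitesPerDir_run_zero lineBond_src_succ lineBond_src_sitesPerDir exists_bond_gt_of_chainHol_gt not_hsupp_of_unreachable)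
open Summit.QuantumFields.YangMills.Theorems.FluctuationComparisonRegPrIntLS2BetaSmallBondGaugeToronAbelianStratum
  (coe_expPoint_e0 coe_expPoint_e0_pow covConst_dirField_rel covConst_dirField_commute_pow offDiag_eq_zero_of_commute_diag eq_of_forall_shift_eq)

variable {P : Params} {j : ℕ}

/-! ## §1 The `e₁`-exponential is a real rotation matrix -/

/-- `ι e₁ = j`. [folklore] -/
theorem imQuat_e1 : imQuat (EuclideanSpace.single (1 : Fin 3) (1 : ℝ)) = ⟨0, 0, 1, 0⟩ := by
  rw [T4HaarSU2ExpChart.imQuat_apply]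
  ext <;> simp

/-- The matrix of `exp(θ·e₁)` is the real rotation `[[cos θ, sin θ], [−sin θ, cos θ]]`. [folklore] -/
theorem coe_expPoint_e1 (θ : ℝ) :
    ((expPoint (θ • EuclideanSpace.single (1 : Fin 3) (1 : ℝ)) : SU2) : Matrix (Fin 2) (Fin 2) ℂ) =
      !![(⟨Real.cos θ, 0⟩ : ℂ), ⟨Real.sin θ, 0⟩; -(⟨Real.sin θ, 0⟩ : ℂ), ⟨Real.cos θ, 0⟩] := by
  have hq : su2Quat (expPoint (θ • EuclideanSpace.single (1 : Fin 3) (1 : ℝ))) = ⟨Real.cos θ, 0, Real.sin θ, 0⟩ := by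
    rw [su2Quat_expPoint, exp_imQuat_smul (by rw [PiLp.norm_single, norm_one]), imQuat_e1]
    ext <;> simp
  rw [← quatMatrix_su2Quat, hq]
  ext i k
  fin_cases i <;> fin_cases k <;> simp [quatMatrix_apply_00, quatMatrix_apply_01, quatMatrix_apply_10, quatMatrix_apply_11, Complex.ext_iff]

/-! ## §2 Direction fields: plaquettes, the Polyakov line, scalar covariantly constant fields -/

/-- The plaquette variables of a direction field are the commutators `f μ · f ν · (f μ)⁻¹ · (f ν)⁻¹`. [folklore] -/
theorem plaqHol_dirField (f : Fin P.d → SU2) (p : Plaq P j) :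
    GaugeField.plaqHol (fun b : PBond P j => f b.dir) p = f p.μ * f p.ν * (f p.μ)⁻¹ * (f p.ν)⁻¹ := rfl

/-- Hence they are bounded by twice the SMALLER of the two bond sizes: `dist1 ≤ 2·dist1(f ν)` … [folklore] -/
theorem dist1_plaqHol_dirField_le_right (f : Fin P.d → SU2) (p : Plaq P j) :
    dist1 (GaugeField.plaqHol (fun b : PBond P j => f b.dir) p) ≤ 2 * dist1 (f p.ν) := by
  rw [plaqHol_dirField]
  calc dist1 (f p.μ * f p.ν * (f p.μ)⁻¹ * (f p.ν)⁻¹) ≤ dist1 (f p.μ * f p.ν * (f p.μ)⁻¹) + dist1 (f p.ν)⁻¹ := GaugeGroup.dist1_mul_le _ _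
    _ = 2 * dist1 (f p.ν) := by rw [GaugeGroup.dist1_conj, GaugeGroup.dist1_inv]; ring

/-- … and `dist1 ≤ 2·dist1(f μ)`. [folklore] -/
theorem dist1_plaqHol_dirField_le_left (f : Fin P.d → SU2) (p : Plaq P j) :
    dist1 (GaugeField.plaqHol (fun b : PBond P j => f b.dir) p) ≤ 2 * dist1 (f p.μ) := by
  rw [plaqHol_dirField]
  have h : f p.μ * f p.ν * (f p.μ)⁻¹ * (f p.ν)⁻¹ = f p.μ * (f p.ν * (f p.μ)⁻¹ * (f p.ν)⁻¹) := by simp only [mul_assoc]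
  rw [h]
  calc dist1 (f p.μ * (f p.ν * (f p.μ)⁻¹ * (f p.ν)⁻¹)) ≤ dist1 (f p.μ) + dist1 (f p.ν * (f p.μ)⁻¹ * (f p.ν)⁻¹) := GaugeGroup.dist1_mul_le _ _
    _ = 2 * dist1 (f p.μ) := by rw [GaugeGroup.dist1_conj, GaugeGroup.dist1_inv]; ring

/-- A direction field all of whose bonds but ONE direction's are `δ`-small has `2δ`-small plaquettes (every plaquette has a second direction). [folklore] -/
theorem plaqSmall_dirField (f : Fin P.d → SU2) (μ₀ : Fin P.d) {δ θ : ℝ} (hsmall : ∀ μ, μ ≠ μ₀ → dist1 (f μ) ≤ δ) (hδ : 2 * δ < θ) :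
    PlaqSmall θ (fun b : PBond P j => f b.dir) := by
  intro p
  by_cases hμ : p.μ = μ₀
  · have hν : p.ν ≠ μ₀ := fun h => (ne_of_lt p.hμν) (hμ.trans h.symm)
    exact (dist1_plaqHol_dirField_le_right f p).trans_lt (by linarith [hsmall _ hν])
  · exact (dist1_plaqHol_dirField_le_left f p).trans_lt (by linarith [hsmall _ hμ])

/-- The product of a direction field along `n` bonds of direction `μ` is `(f μ)^n`. [folklore] -/
theorem prod_dirField_line (f : Fin P.d → SU2) (μ : Fin P.d) (x : ℕ → Site P j) (n : ℕ) :
    ((List.range n).map fun i => (fun b : PBond P j => f b.dir) ⟨x i, μ⟩).prod = f μ ^ n := by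
  simp only [List.map_const', List.prod_replicate, List.length_range]

/-- A diagonal `2×2` matrix commuting with a genuine rotation `[[c, s], [−s, c]]`, `s ≠ 0`, is scalar. [folklore] -/
theorem diag_eq_of_commute_rot {c s : ℂ} (hs : s ≠ 0) (C : Matrix (Fin 2) (Fin 2) ℂ) (h01 : C 0 1 = 0)
    (h : C * !![c, s; -s, c] = !![c, s; -s, c] * C) : C 0 0 = C 1 1 := by
  have h' := congrFun (congrFun h 0) 1
  simp [Matrix.mul_apply, Fin.sum_univ_two, h01] at h'
  have : (C 0 0 - C 1 1) * s = 0 := by linear_combination h'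
  exact sub_eq_zero.1 ((mul_eq_zero.1 this).resolve_right hs)

/-- ★★ **COVARIANTLY CONSTANT FIELDS OVER A TWO-AXIS DIRECTION FIELD ARE SCALAR CONSTANTS**: if in direction `μ₀` the Polyakov power is `diag(z_N, w_N)`, `z_N ≠ w_N`, and in direction
`μ₁` it is a genuine rotation `[[c, s], [−s, c]]`, `s ≠ 0`, then every matrix field transported by `b ↦ f(b.dir)` into itself is `z·1`. [folklore] -/
theorem covConst_dirField_scalar (f : Fin P.d → SU2) (μ₀ μ₁ : Fin P.d) {zN wN : ℂ}
    (hN0 : ((f μ₀ ^ P.sitesPerDir j : SU2) : Matrix (Fin 2) (Fin 2) ℂ) = !![zN, 0; 0, wN]) (hzw : zN ≠ wN)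
    {c s : ℂ} (hN1 : ((f μ₁ ^ P.sitesPerDir j : SU2) : Matrix (Fin 2) (Fin 2) ℂ) = !![c, s; -s, c]) (hs : s ≠ 0)
    (cf : Site P j → Matrix (Fin 2) (Fin 2) ℂ)
    (hc : ∀ e : PBond P j, cf e.src =
      ((unitsField (toUField (fun b : PBond P j => f b.dir)) e : (Matrix (Fin 2) (Fin 2) ℂ)ˣ) : Matrix (Fin 2) (Fin 2) ℂ) * cf e.tgt *
      (((unitsField (toUField (fun b : PBond P j => f b.dir)) e)⁻¹ : (Matrix (Fin 2) (Fin 2) ℂ)ˣ) : Matrix (Fin 2) (Fin 2) ℂ)) :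
    ∃ z : ℂ, ∀ y, cf y = z • (1 : Matrix (Fin 2) (Fin 2) ℂ) := by
  have hrel := covConst_dirField_rel f cf hc
  have hdiag : ∀ x, cf x 0 1 = 0 ∧ cf x 1 0 = 0 := fun x =>
    offDiag_eq_zero_of_commute_diag hzw (cf x) (by rw [← hN0]; exact covConst_dirField_commute_pow (f μ₀) μ₀ cf (fun y => hrel y μ₀) x)
  have hscal : ∀ x, cf x = (cf x 0 0) • (1 : Matrix (Fin 2) (Fin 2) ℂ) := by
    intro x
    have h00 : cf x 0 0 = cf x 1 1 :=
      diag_eq_of_commute_rot hs (cf x) (hdiag x).1 (by rw [← hN1]; exact covConst_dirField_commute_pow (f μ₁) μ₁ cf (fun y => hrel y μ₁) x)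
    rw [Matrix.eta_fin_two (cf x), (hdiag x).1, (hdiag x).2, ← h00]
    ext i k; fin_cases i <;> fin_cases k <;> simp
  -- scalars are central: shift invariance in every direction
  have hshift : ∀ (x : Site P j) (μ : Fin P.d), cf (x.shift μ) = cf x := fun x μ => by
    have hinv : (f μ : Matrix (Fin 2) (Fin 2) ℂ) * (((f μ)⁻¹ : SU2) : Matrix (Fin 2) (Fin 2) ℂ) = 1 := by
      rw [← Submonoid.coe_mul, mul_inv_cancel]; rfl
    rw [hrel x μ, hscal (x.shift μ), Matrix.mul_smul, Matrix.mul_one, Matrix.smul_mul, hinv]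
  exact ⟨cf default 0 0, fun y => (eq_of_forall_shift_eq cf hshift y default).trans (hscal default)⟩

/-! ## §3 The two-axis torus on the irreducible stratum and the refutation of the `IRR`-supplier -/

/-- ★★ **THE TWO-AXIS NEAR-FLAT TORUS IS IRREDUCIBLE**: on the unit lattice of run `J` (`N = sitesPerDir`), the direction field `(e^{a·e₀σ}, e^{ε·e₁σ}, 1, …)` satisfies the `IRR`
guard of ✓`uniformFibreGapOrbit_of_gaugedLetters` (`hD₁`∕`hF₁`) VERBATIM as soon as `sin(Na) ≠ 0` and `sin(Nε) ≠ 0`. [folklore] -/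
theorem dirField_mem_irrStratum (F : T3Family) (J : ℕ) {a ε : ℝ} (hsa : Real.sin ((((F.P J).sitesPerDir 0 : ℕ) : ℝ) * a) ≠ 0)
    (hse : Real.sin ((((F.P J).sitesPerDir 0 : ℕ) : ℝ) * ε) ≠ 0) :
    ∀ c : Site (F.P J) 0 → Matrix (Fin 2) (Fin 2) ℂ,
      (∀ e : PBond (F.P J) 0, c e.src = ((unitsField (toUField
          (fun b : PBond (F.P J) 0 => (fun μ : Fin (F.P J).d => if μ = ⟨0, (F.P J).hd⟩ then expPoint (a • EuclideanSpace.single (0 : Fin 3) (1 : ℝ))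
            else if μ = ⟨1, by rw [T3Family.P_d]; norm_num⟩ then expPoint (ε • EuclideanSpace.single (1 : Fin 3) (1 : ℝ)) else 1) b.dir)) e :
          (Matrix (Fin 2) (Fin 2) ℂ)ˣ) : Matrix (Fin 2) (Fin 2) ℂ) * c e.tgt *
        (((unitsField (toUField
          (fun b : PBond (F.P J) 0 => (fun μ : Fin (F.P J).d => if μ = ⟨0, (F.P J).hd⟩ then expPoint (a • EuclideanSpace.single (0 : Fin 3) (1 : ℝ))
            else if μ = ⟨1, by rw [T3Family.P_d]; norm_num⟩ then expPoint (ε • EuclideanSpace.single (1 : Fin 3) (1 : ℝ)) else 1) b.dir)) e)⁻¹ :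
          (Matrix (Fin 2) (Fin 2) ℂ)ˣ) : Matrix (Fin 2) (Fin 2) ℂ)) →
      ∃ z : ℂ, ∀ y, c y = z • (1 : Matrix (Fin 2) (Fin 2) ℂ) := by
  intro c hc
  have h10 : (⟨1, by rw [T3Family.P_d]; norm_num⟩ : Fin (F.P J).d) ≠ ⟨0, (F.P J).hd⟩ := by simp
  refine covConst_dirField_scalar (P := F.P J) (j := 0)
    (fun μ : Fin (F.P J).d => if μ = ⟨0, (F.P J).hd⟩ then expPoint (a • EuclideanSpace.single (0 : Fin 3) (1 : ℝ))
      else if μ = ⟨1, by rw [T3Family.P_d]; norm_num⟩ then expPoint (ε • EuclideanSpace.single (1 : Fin 3) (1 : ℝ)) else 1)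
    ⟨0, (F.P J).hd⟩ ⟨1, by rw [T3Family.P_d]; norm_num⟩
    (zN := ⟨Real.cos ((((F.P J).sitesPerDir 0 : ℕ) : ℝ) * a), Real.sin ((((F.P J).sitesPerDir 0 : ℕ) : ℝ) * a)⟩)
    (wN := ⟨Real.cos ((((F.P J).sitesPerDir 0 : ℕ) : ℝ) * a), -Real.sin ((((F.P J).sitesPerDir 0 : ℕ) : ℝ) * a)⟩)
    (by rw [if_pos rfl]; exact coe_expPoint_e0_pow a _) (fun h => hsa ?_)
    (c := ⟨Real.cos ((((F.P J).sitesPerDir 0 : ℕ) : ℝ) * ε), 0⟩) (s := ⟨Real.sin ((((F.P J).sitesPerDir 0 : ℕ) : ℝ) * ε), 0⟩)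
    (by rw [if_neg h10, if_pos rfl, expPoint_smul_pow, coe_expPoint_e1]) (fun h => hse ?_) c hc
  · have him : Real.sin ((((F.P J).sitesPerDir 0 : ℕ) : ℝ) * a) = -Real.sin ((((F.P J).sitesPerDir 0 : ℕ) : ℝ) * a) := congrArg Complex.im h
    linarith
  · exact congrArg Complex.re h

/-- ★★★ **THE `IRR`-STRATUM SMALL-BOND SUPPLIER IS FALSE** (✓p824968's `hsupp` with `G :=` the `IRR` guard of ✓p821904 VERBATIM, `G′ := G ∧ «∀ e, arc(V e) ≤ M»`): at block size `L`
(odd, `> 1`), for every angle `0 < a` with `2L·a ≤ π`, `sin(2L·a) ≠ 0` and every `M < a` — via ✓`not_hsupp_of_unreachable` at `F = ⟨L, 1⟩`, `J = 0`: for each `θ > 0` the two-axis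
torus with `ε := min(θ∕4, π∕(4L))` has `θ`-small plaquettes, is irreducible, and its direction-`0` Polyakov arc `2L·a > 2L·M` defeats every gauge. [folklore] -/
theorem not_hsupp_irrStratum (L : ℕ) (hL : Odd L ∧ 1 < L) {a M : ℝ} (ha : 0 < a) (ha2L : ((2 * L : ℕ) : ℝ) * a ≤ π)
    (hsin : Real.sin (((2 * L : ℕ) : ℝ) * a) ≠ 0) (hM : M < a) :
    ¬ (∀ (L : ℕ), ∃ c₀ : ℝ, 0 < c₀ ∧ c₀ ≤ 1 ∧ ∀ (cw : ℝ), 0 < cw → cw ≤ c₀ → ∃ pS : ℝ, ∀ (b₀ p₀ : ℝ), 0 < b₀ → pS ≤ p₀ → 0 < p₀ →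
      ∃ γ₁ : ℝ, 0 < γ₁ ∧ ∀ (F : T3Family) (γ : ℝ), F.L = L → 0 < γ → γ ≤ γ₁ →
        ∀ (J : ℕ) (V : GaugeField (F.P J) 0 (Matrix.specialUnitaryGroup (Fin 2) ℂ)), PlaqSmall (θBal F.L γ (cw * b₀) p₀ J) V →
          (∀ c : Site (F.P J) 0 → Matrix (Fin 2) (Fin 2) ℂ,
            (∀ e : PBond (F.P J) 0, c e.src = ((unitsField (toUField V) e : (Matrix (Fin 2) (Fin 2) ℂ)ˣ) : Matrix (Fin 2) (Fin 2) ℂ) * c e.tgt *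
              (((unitsField (toUField V) e)⁻¹ : (Matrix (Fin 2) (Fin 2) ℂ)ˣ) : Matrix (Fin 2) (Fin 2) ℂ)) →
            ∃ z : ℂ, ∀ y, c y = z • (1 : Matrix (Fin 2) (Fin 2) ℂ)) →
          ∃ u : GaugeTransf (F.P J) 0 (Matrix.specialUnitaryGroup (Fin 2) ℂ),
            ((∀ c : Site (F.P J) 0 → Matrix (Fin 2) (Fin 2) ℂ,
              (∀ e : PBond (F.P J) 0, c e.src = ((unitsField (toUField (GaugeField.gaugeAct u V)) e : (Matrix (Fin 2) (Fin 2) ℂ)ˣ) : Matrix (Fin 2) (Fin 2) ℂ) * c e.tgt *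
                (((unitsField (toUField (GaugeField.gaugeAct u V)) e)⁻¹ : (Matrix (Fin 2) (Fin 2) ℂ)ˣ) : Matrix (Fin 2) (Fin 2) ℂ)) →
              ∃ z : ℂ, ∀ y, c y = z • (1 : Matrix (Fin 2) (Fin 2) ℂ)) ∧
            ∀ e : PBond (F.P J) 0, ‖logVec (su2Quat (GaugeField.gaugeAct u V e))‖ ≤ M)) := by
  refine not_hsupp_of_unreachable
    (fun (F : T3Family) (J : ℕ) (V : GaugeField (F.P J) 0 (Matrix.specialUnitaryGroup (Fin 2) ℂ)) =>
      ∀ c : Site (F.P J) 0 → Matrix (Fin 2) (Fin 2) ℂ,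
        (∀ e : PBond (F.P J) 0, c e.src = ((unitsField (toUField V) e : (Matrix (Fin 2) (Fin 2) ℂ)ˣ) : Matrix (Fin 2) (Fin 2) ℂ) * c e.tgt *
          (((unitsField (toUField V) e)⁻¹ : (Matrix (Fin 2) (Fin 2) ℂ)ˣ) : Matrix (Fin 2) (Fin 2) ℂ)) →
        ∃ z : ℂ, ∀ y, c y = z • (1 : Matrix (Fin 2) (Fin 2) ℂ))
    (fun (F : T3Family) (J : ℕ) (V : GaugeField (F.P J) 0 (Matrix.specialUnitaryGroup (Fin 2) ℂ)) =>
      (∀ c : Site (F.P J) 0 → Matrix (Fin 2) (Fin 2) ℂ,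
        (∀ e : PBond (F.P J) 0, c e.src = ((unitsField (toUField V) e : (Matrix (Fin 2) (Fin 2) ℂ)ˣ) : Matrix (Fin 2) (Fin 2) ℂ) * c e.tgt *
          (((unitsField (toUField V) e)⁻¹ : (Matrix (Fin 2) (Fin 2) ℂ)ˣ) : Matrix (Fin 2) (Fin 2) ℂ)) →
        ∃ z : ℂ, ∀ y, c y = z • (1 : Matrix (Fin 2) (Fin 2) ℂ)) ∧
      ∀ e : PBond (F.P J) 0, ‖logVec (su2Quat (V e))‖ ≤ M)
    L ⟨⟨L, hL, 1, le_rfl⟩, 0, rfl, fun θ hθ => ?_⟩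
  set F : T3Family := ⟨L, hL, 1, le_rfl⟩ with hF
  have hN : (F.P 0).sitesPerDir 0 = 2 * L := by
    rw [sitesPerDir_run_zero]; show 2 * L ^ 1 = 2 * L; rw [pow_one]
  have hNpos : (0 : ℝ) < ((2 * L : ℕ) : ℝ) := by have := hL.2; positivity
  -- the transverse twist `ε`
  set ε : ℝ := min (θ / 4) (π / (2 * ((2 * L : ℕ) : ℝ))) with hε
  have hε0 : 0 < ε := lt_min (by linarith) (by positivity)
  have hεθ : ε ≤ θ / 4 := min_le_left _ _
  have hNε : ((2 * L : ℕ) : ℝ) * ε ≤ π / 2 := by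
    calc ((2 * L : ℕ) : ℝ) * ε ≤ ((2 * L : ℕ) : ℝ) * (π / (2 * ((2 * L : ℕ) : ℝ))) := mul_le_mul_of_nonneg_left (min_le_right _ _) hNpos.le
      _ = π / 2 := by field_simp
  have hsinε : Real.sin (((2 * L : ℕ) : ℝ) * ε) ≠ 0 :=
    (Real.sin_pos_of_pos_of_lt_pi (mul_pos hNpos hε0) (by linarith [Real.pi_pos])).ne'
  refine ⟨fun b => (fun μ : Fin (F.P 0).d => if μ = ⟨0, (F.P 0).hd⟩ then expPoint (a • EuclideanSpace.single (0 : Fin 3) (1 : ℝ))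
      else if μ = ⟨1, by rw [T3Family.P_d]; norm_num⟩ then expPoint (ε • EuclideanSpace.single (1 : Fin 3) (1 : ℝ)) else 1) b.dir, ?_, ?_, ?_⟩
  · -- small plaquettes: every direction but `0` carries a bond of size `≤ 2|sin(ε/2)| ≤ ε ≤ θ/4`
    refine plaqSmall_dirField
      (fun μ : Fin (F.P 0).d => if μ = ⟨0, (F.P 0).hd⟩ then expPoint (a • EuclideanSpace.single (0 : Fin 3) (1 : ℝ))
        else if μ = ⟨1, by rw [T3Family.P_d]; norm_num⟩ then expPoint (ε • EuclideanSpace.single (1 : Fin 3) (1 : ℝ)) else 1)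
      ⟨0, (F.P 0).hd⟩ (δ := θ / 4) (fun μ hμ => ?_) (by linarith)
    simp only [if_neg hμ]
    by_cases h1 : μ = ⟨1, by rw [T3Family.P_d]; norm_num⟩
    · rw [if_pos h1, dist1_expPoint_smul (by rw [PiLp.norm_single, norm_one])]
      have hs1 : |Real.sin (ε / 2)| ≤ ε / 2 := Real.abs_sin_le_abs.trans (abs_of_pos (by linarith)).le
      linarith
    · rw [if_neg h1, GaugeGroup.dist1_one]; linarith
  · -- irreducible
    have hsa : Real.sin ((((F.P 0).sitesPerDir 0 : ℕ) : ℝ) * a) ≠ 0 := by rw [hN]; exact hsin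
    have hse : Real.sin ((((F.P 0).sitesPerDir 0 : ℕ) : ℝ) * ε) ≠ 0 := by rw [hN]; exact hsinε
    exact dirField_mem_irrStratum F 0 hsa hse
  · -- no gauge reaches the small-bond guard: the direction-`0` Polyakov arc is `2L·a > 2L·M`
    rintro u ⟨-, hu⟩
    set V : GaugeField (F.P 0) 0 SU2 := fun b => (fun μ : Fin (F.P 0).d => if μ = ⟨0, (F.P 0).hd⟩ then expPoint (a • EuclideanSpace.single (0 : Fin 3) (1 : ℝ))
      else if μ = ⟨1, by rw [T3Family.P_d]; norm_num⟩ then expPoint (ε • EuclideanSpace.single (1 : Fin 3) (1 : ℝ)) else 1) b.dir with hV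
    set x₀ : Site (F.P 0) 0 := default with hx₀
    set bch : ℕ → PBond (F.P 0) 0 := fun i => ⟨Function.update x₀ ⟨0, (F.P 0).hd⟩ (x₀ ⟨0, (F.P 0).hd⟩ + (i : ZMod ((F.P 0).sitesPerDir 0))), ⟨0, (F.P 0).hd⟩⟩
      with hbch
    have hVb : ∀ i, V (bch i) = expPoint (a • EuclideanSpace.single (0 : Fin 3) (1 : ℝ)) := fun i => by
      simp only [hV, hbch, if_pos rfl]
    have hprod : ((List.range ((F.P 0).sitesPerDir 0)).map fun i => V (bch i)).prod =
        expPoint (a • EuclideanSpace.single (0 : Fin 3) (1 : ℝ)) ^ (F.P 0).sitesPerDir 0 := by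
      simp only [hVb, List.map_const', List.prod_replicate, List.length_range]
    have hnorm : ‖((((F.P 0).sitesPerDir 0 : ℕ) : ℝ) * a) • EuclideanSpace.single (0 : Fin 3) (1 : ℝ)‖ = (((F.P 0).sitesPerDir 0 : ℕ) : ℝ) * a := by
      rw [norm_smul, PiLp.norm_single, norm_one, mul_one, Real.norm_eq_abs, abs_of_pos (mul_pos (by rw [hN]; exact hNpos) ha)]
    have hbig : ((F.P 0).sitesPerDir 0 : ℝ) * M < ‖logVec (su2Quat ((List.range ((F.P 0).sitesPerDir 0)).map fun i => V (bch i)).prod)‖ := by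
      rw [hprod, expPoint_smul_pow, norm_logVec_su2Quat_expPoint (by rw [hnorm, hN]; exact ha2L), hnorm]
      exact mul_lt_mul_of_pos_left hM (by rw [hN]; exact hNpos)
    obtain ⟨i, -, hi⟩ := exists_bond_gt_of_chainHol_gt V bch (fun i => lineBond_src_succ x₀ _ i) (lineBond_src_sitesPerDir x₀ _) hbig u
    exact absurd (hu (bch i)) (not_le.2 hi)

/-- ★★★ **AT THE CELL's BLOCK SIZE `L = 5`**: the `IRR`-stratum small-bond supplier is false for every `M ≤ 1∕4` (angle `a = π∕12`, `N = 10`). [folklore] -/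
theorem not_hsupp_irrStratum_five {M : ℝ} (hM : M ≤ 1 / 4) :
    ¬ (∀ (L : ℕ), ∃ c₀ : ℝ, 0 < c₀ ∧ c₀ ≤ 1 ∧ ∀ (cw : ℝ), 0 < cw → cw ≤ c₀ → ∃ pS : ℝ, ∀ (b₀ p₀ : ℝ), 0 < b₀ → pS ≤ p₀ → 0 < p₀ →
      ∃ γ₁ : ℝ, 0 < γ₁ ∧ ∀ (F : T3Family) (γ : ℝ), F.L = L → 0 < γ → γ ≤ γ₁ →
        ∀ (J : ℕ) (V : GaugeField (F.P J) 0 (Matrix.specialUnitaryGroup (Fin 2) ℂ)), PlaqSmall (θBal F.L γ (cw * b₀) p₀ J) V →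
          (∀ c : Site (F.P J) 0 → Matrix (Fin 2) (Fin 2) ℂ,
            (∀ e : PBond (F.P J) 0, c e.src = ((unitsField (toUField V) e : (Matrix (Fin 2) (Fin 2) ℂ)ˣ) : Matrix (Fin 2) (Fin 2) ℂ) * c e.tgt *
              (((unitsField (toUField V) e)⁻¹ : (Matrix (Fin 2) (Fin 2) ℂ)ˣ) : Matrix (Fin 2) (Fin 2) ℂ)) →
            ∃ z : ℂ, ∀ y, c y = z • (1 : Matrix (Fin 2) (Fin 2) ℂ)) →
          ∃ u : GaugeTransf (F.P J) 0 (Matrix.specialUnitaryGroup (Fin 2) ℂ),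
            ((∀ c : Site (F.P J) 0 → Matrix (Fin 2) (Fin 2) ℂ,
              (∀ e : PBond (F.P J) 0, c e.src = ((unitsField (toUField (GaugeField.gaugeAct u V)) e : (Matrix (Fin 2) (Fin 2) ℂ)ˣ) : Matrix (Fin 2) (Fin 2) ℂ) * c e.tgt *
                (((unitsField (toUField (GaugeField.gaugeAct u V)) e)⁻¹ : (Matrix (Fin 2) (Fin 2) ℂ)ˣ) : Matrix (Fin 2) (Fin 2) ℂ)) →
              ∃ z : ℂ, ∀ y, c y = z • (1 : Matrix (Fin 2) (Fin 2) ℂ)) ∧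
            ∀ e : PBond (F.P J) 0, ‖logVec (su2Quat (GaugeField.gaugeAct u V e))‖ ≤ M)) := by
  have hπ := Real.pi_gt_three
  have h10 : ((2 * 5 : ℕ) : ℝ) * (π / 12) = 5 * π / 6 := by push_cast; ring
  refine not_hsupp_irrStratum 5 ⟨by decide, by decide⟩ (a := π / 12) (by positivity) (by rw [h10]; linarith) ?_ (by linarith)
  rw [h10, show 5 * π / 6 = π - π / 6 by ring, Real.sin_pi_sub, Real.sin_pi_div_six]
  norm_num

end Summit.QuantumFields.YangMills.Theorems.FluctuationComparisonRegPrIntLS2BetaSmallBondGaugeToronIrreducibleStratum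

end
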